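import Mathlib
import HarnessLib

/-!
# Crux `NNLinearDegreeCofactorHard` (stmt-ValiantsHypothesis-23918), line `internal_cofactor`, stub S2b:
# the BLOCK test lemma (adaptive forbidden pattern SETS on disjoint blocks of bits)

Generalisation of the landed pair test lemma `card_filter_avoid_mul_four_pow` / `card_filter_avoid_le`
(`Theorems/FifoMatchingNNMonotoneHardTests.lean`, piece (B) of the thick-queue measure: letter PAIRS, ONE forbidden
pattern, price `3/4`) to what a DRIFTED thick-queue measure needs (workfile
`Cruxes/NNLinearDegreeCofactorHard/Lines/internal_cofactor-S2b-measure-constraints.md`, §5: letters coded by blocks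
of uniform bits so that biased letters stay a COUNTING model): fix a set `P` of block starts `p` (`p + b ≤ N`),
pairwise `≥ b` apart (disjoint blocks `[p, p+b)`), and for each `p ∈ P` a forbidden SET `Φ p v` of block contents
(`Fin b → Bool`) that depends on the word `v` only through its STRICT PAST (the bits `v i`, `i < p`) and always has
at least `f` elements.  Then

* `card_filter_blockAvoid_le` — `#{v : Fin N → Bool | ∀ p ∈ P, v|[p,p+b) ∉ Φ p v} · (2^b)^{|P|} ≤ (2^b − f)^{|P|} · 2^N`,

i.e. under the uniform measure on bit-strings, avoiding `|P|` adaptively forbidden pattern sets costs a factor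
`(1 − f/2^b)` each (`b = 2`, `f = 1`, singleton sets: the landed `3/4`; `b = 4`, `f = 2`: the `7/8` of two consecutive
2-bit-coded letters).  Proof: the landed induction on `P` through its maximum `a` (`Finset.induction_on_max`) with the
pair `{a−1, a}` replaced by the block `[a, a+b)`: the avoidance conditions below `a` and the set `Φ a` do not see the
block's bits, so on each fibre of «blank the block» at most `2^b − f` of the `2^b` words avoid `Φ a`.

Honest framing: elementary counting; nothing here is specific to matchings; stub S2b, the crux and VP ≠ VNP are not
touched.  No definitions, no named facts.
-/

-- Sub = Summit single-conjunct layout: the duplicated namespace component is mandated by the tree.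
set_option linter.dupNamespace false

namespace Summit.ValiantsHypothesis.ValiantsHypothesis.Theorems.FifoMatching.NNLinearDegreeCofactorHard.BlockTests

open Finset

variable {N : ℕ}

/-- **The block test lemma.**  Let `P` be a set of block starts `p` in `Fin N` with `p + b ≤ N`, pairwise `≥ b`
apart, and let `Φ p v : Finset (Fin b → Bool)` depend on the word `v` only through the bits `v i` with `i < p` and
have at least `f` elements.  Then the number of words `v : Fin N → Bool` whose block `k ↦ v (p + k)` avoids `Φ p v`
for every `p ∈ P` satisfies `# · (2^b)^{|P|} ≤ (2^b − f)^{|P|} · 2^N`. [folklore] -/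
theorem card_filter_blockAvoid_le (b f : ℕ) (P : Finset (Fin N)) (hP : ∀ p ∈ P, (p : ℕ) + b ≤ N)
    (hsep : ∀ p ∈ P, ∀ q ∈ P, p < q → (p : ℕ) + b ≤ q)
    (Φ : Fin N → (Fin N → Bool) → Finset (Fin b → Bool))
    (hΦ : ∀ p ∈ P, ∀ v w : Fin N → Bool, (∀ i : Fin N, (i : ℕ) < p → v i = w i) → Φ p v = Φ p w)
    (hf : ∀ p ∈ P, ∀ v : Fin N → Bool, f ≤ (Φ p v).card) :
    (univ.filter fun v : Fin N → Bool => ∀ p ∈ P,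
        (fun k : Fin b => if h : (p : ℕ) + k < N then v ⟨(p : ℕ) + k, h⟩ else false) ∉ Φ p v).card
        * (2 ^ b) ^ P.card ≤ (2 ^ b - f) ^ P.card * 2 ^ N := by
  classical
  induction P using Finset.induction_on_max with
  | empty =>
    simp only [notMem_empty, IsEmpty.forall_iff, implies_true, filter_true_of_mem, mem_univ,
      card_univ, card_empty, pow_zero, mul_one, one_mul, Fintype.card_fun, Fintype.card_bool,
      Fintype.card_fin, le_refl]
  | insert a s hlt ih =>
    have hPs : ∀ p ∈ s, (p : ℕ) + b ≤ N := fun p hp => hP p (mem_insert_of_mem hp)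
    have hseps : ∀ p ∈ s, ∀ q ∈ s, p < q → (p : ℕ) + b ≤ q := fun p hp q hq =>
      hsep p (mem_insert_of_mem hp) q (mem_insert_of_mem hq)
    have hΦs : ∀ p ∈ s, ∀ v w : Fin N → Bool, (∀ i : Fin N, (i : ℕ) < p → v i = w i) →
        Φ p v = Φ p w := fun p hp => hΦ p (mem_insert_of_mem hp)
    have hfs : ∀ p ∈ s, ∀ v : Fin N → Bool, f ≤ (Φ p v).card := fun p hp => hf p (mem_insert_of_mem hp)
    have IH := ih hPs hseps hΦs hfs
    have haN : (a : ℕ) + b ≤ N := hP a (mem_insert_self a s)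
    have has : a ∉ s := fun h => lt_irrefl a (hlt a h)
    have hsa : ∀ p ∈ s, (p : ℕ) + b ≤ a := fun p hp =>
      hsep p (mem_insert_of_mem hp) a (mem_insert_self a s) (hlt p hp)
    -- reading a block, and the predicates
    set rd : Fin N → (Fin N → Bool) → (Fin b → Bool) := fun p v k =>
      if h : (p : ℕ) + k < N then v ⟨(p : ℕ) + k, h⟩ else false with hrd
    set As : (Fin N → Bool) → Prop := fun v => ∀ p ∈ s, rd p v ∉ Φ p v with hAs
    set Av : (Fin N → Bool) → Prop := fun v => rd a v ∉ Φ a v with hAv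
    have hsplit : (univ.filter fun v : Fin N → Bool => ∀ p ∈ insert a s, rd p v ∉ Φ p v)
        = univ.filter fun v => As v ∧ Av v := by
      ext v
      simp only [mem_filter, mem_univ, true_and, forall_mem_insert, hAs, hAv]
      tauto
    rw [hsplit, card_insert_of_notMem has, pow_succ, ← mul_assoc]
    -- blanking / overwriting the block `[a, a+b)`
    set e : (Fin N → Bool) → (Fin N → Bool) := fun v i =>
      if (a : ℕ) ≤ i ∧ (i : ℕ) < a + b then false else v i with he
    set g : (Fin N → Bool) → (Fin b → Bool) → (Fin N → Bool) := fun w x i =>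
      if h : (a : ℕ) ≤ i ∧ (i : ℕ) < a + b then x ⟨(i : ℕ) - a, by omega⟩ else w i with hg
    have hrd_g : ∀ w x, rd a (g w x) = x := by
      intro w x
      funext k
      have hk : (a : ℕ) + k < N := by omega
      simp only [hrd, hg, dif_pos hk]
      rw [dif_pos ⟨by simp, by simp⟩]
      congr 1
      ext
      simp
    have hg_inj : ∀ w, Function.Injective (g w) := by
      intro w x x' h
      have := hrd_g w x
      rw [h, hrd_g] at this
      exact this.symm
    have hg_apply_of_not : ∀ w x (i : Fin N), ¬ ((a : ℕ) ≤ i ∧ (i : ℕ) < a + b) → g w x i = w i :=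
      fun w x i hi => by simp only [hg, dif_neg hi]
    -- the image of `e`
    set T : Finset (Fin N → Bool) :=
      univ.filter fun w => ∀ i : Fin N, (a : ℕ) ≤ i ∧ (i : ℕ) < a + b → w i = false with hT
    have he_mem : ∀ v, e v ∈ T := fun v => by
      simp only [hT, he, mem_filter, mem_univ, true_and]
      intro i hi
      rw [if_pos hi]
    have he_g : ∀ w ∈ T, ∀ x, e (g w x) = w := by
      intro w hw x
      simp only [hT, mem_filter, mem_univ, true_and] at hw
      funext i
      by_cases hi : (a : ℕ) ≤ i ∧ (i : ℕ) < a + b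
      · simp only [he, if_pos hi, hw i hi]
      · simp only [he, if_neg hi, hg, dif_neg hi]
    have hg_e : ∀ v, g (e v) (rd a v) = v := by
      intro v
      funext i
      by_cases hi : (a : ℕ) ≤ i ∧ (i : ℕ) < a + b
      · simp only [hg, dif_pos hi, hrd]
        rw [dif_pos (by omega)]
        congr 1
        ext
        simp only
        omega
      · simp only [hg, dif_neg hi, he, if_neg hi]
    have hfibre : ∀ w ∈ T, (univ.filter fun v => e v = w) = univ.image (g w) := by
      intro w hw
      ext v
      simp only [mem_filter, mem_univ, true_and, mem_image]
      constructor
      · intro hv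
        exact ⟨rd a v, by rw [← hv]; exact hg_e v⟩
      · rintro ⟨x, rfl⟩
        exact he_g w hw x
    -- invariance of `As` and of `Φ a` along fibres
    have hAs_g : ∀ w x, As (g w x) ↔ As w := by
      intro w x
      have hcoord : ∀ p ∈ s, ∀ i : Fin N, (i : ℕ) < p + b → g w x i = w i := by
        intro p hp i hi
        exact hg_apply_of_not w x i (by have := hsa p hp; omega)
      have hrdp : ∀ p ∈ s, rd p (g w x) = rd p w := by
        intro p hp
        funext k
        simp only [hrd]
        split_ifs with hk
        · exact hcoord p hp _ (by dsimp only; omega)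
        · rfl
      simp only [hAs]
      refine forall₂_congr fun p hp => ?_
      rw [hrdp p hp, hΦs p hp (g w x) w fun i hi => hcoord p hp i (by omega)]
    have hΦa_g : ∀ w x, Φ a (g w x) = Φ a w := by
      intro w x
      exact hΦ a (mem_insert_self a s) _ _ fun i hi => hg_apply_of_not w x i (by omega)
    -- count `As` fibrewise: each fibre over `w ∈ T` with `As w` has `2^b` elements
    have hcardB : (univ : Finset (Fin b → Bool)).card = 2 ^ b := by
      simp [card_univ, Fintype.card_bool, Fintype.card_fin]
    have hcountAs : (univ.filter fun v => As v).card = 2 ^ b * (T.filter fun w => As w).card := by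
      rw [card_eq_sum_card_fiberwise (f := e) (t := T) (fun v _ => he_mem v)]
      rw [show 2 ^ b * (T.filter fun w => As w).card = ∑ w ∈ T, if As w then 2 ^ b else 0 by
        rw [← sum_filter, sum_const, smul_eq_mul, mul_comm]]
      refine sum_congr rfl fun w hw => ?_
      have : ((univ.filter fun v => As v).filter fun v => e v = w)
          = (univ.filter fun v => e v = w).filter fun v => As v := by
        ext v; simp only [mem_filter, mem_univ, true_and]; tauto
      rw [this, hfibre w hw, filter_image]
      split_ifs with hAw
      · rw [filter_true_of_mem (fun x _ => (hAs_g w x).2 hAw), card_image_of_injective _ (hg_inj w),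
          hcardB]
      · rw [filter_false_of_mem (fun x _ => fun h => hAw ((hAs_g w x).1 h))]
        simp
    -- count `As ∧ Av` fibrewise: each such fibre has at most `2^b - f` elements avoiding `Φ a w`
    have hcountAv : (univ.filter fun v => As v ∧ Av v).card
        ≤ (2 ^ b - f) * (T.filter fun w => As w).card := by
      rw [card_eq_sum_card_fiberwise (f := e) (t := T) (fun v _ => he_mem v)]
      rw [show (2 ^ b - f) * (T.filter fun w => As w).card
          = ∑ w ∈ T, if As w then (2 ^ b - f) else 0 by
        rw [← sum_filter, sum_const, smul_eq_mul, mul_comm]]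
      refine sum_le_sum fun w hw => ?_
      have : ((univ.filter fun v => As v ∧ Av v).filter fun v => e v = w)
          = (univ.filter fun v => e v = w).filter fun v => As v ∧ Av v := by
        ext v; simp only [mem_filter, mem_univ, true_and]; tauto
      rw [this, hfibre w hw, filter_image]
      split_ifs with hAw
      · have hset : (univ.filter fun x : Fin b → Bool => As (g w x) ∧ Av (g w x))
            = univ \ Φ a w := by
          ext x
          simp only [mem_filter, mem_univ, true_and, mem_sdiff, hAv, hrd_g, hΦa_g, (hAs_g w x),
            hAw]
        rw [card_image_of_injective _ (hg_inj w), hset, card_sdiff_of_subset (subset_univ _), hcardB]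
        exact Nat.sub_le_sub_left (hf a (mem_insert_self a s) w) _
      · rw [filter_false_of_mem (fun x _ => fun h => hAw ((hAs_g w x).1 h.1))]
        simp
    -- conclude
    have IH' : (univ.filter fun v => As v).card * (2 ^ b) ^ s.card ≤ (2 ^ b - f) ^ s.card * 2 ^ N := IH
    rw [hcountAs] at IH'
    calc (univ.filter fun v => As v ∧ Av v).card * (2 ^ b) ^ s.card * 2 ^ b
        ≤ (2 ^ b - f) * (T.filter fun w => As w).card * (2 ^ b) ^ s.card * 2 ^ b := by
          gcongr
      _ = (2 ^ b - f) * (2 ^ b * (T.filter fun w => As w).card * (2 ^ b) ^ s.card) := by ring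
      _ ≤ (2 ^ b - f) * ((2 ^ b - f) ^ s.card * 2 ^ N) := Nat.mul_le_mul_left _ IH'
      _ = (2 ^ b - f) ^ s.card * (2 ^ b - f) * 2 ^ N := by ring

/-- **The block test lemma for a sub-family**: if every word of `A` avoids, on each block `[p, p+b)`, `p ∈ P`, a
pattern set `Φ p` (past-determined, of size `≥ f`), then `|A| · (2^b)^{|P|} ≤ (2^b − f)^{|P|} · 2^N` — under the
uniform measure on bit-strings the `|P|` adaptive tests are passed with probability at most `(1 − f/2^b)^{|P|}`.
[folklore] -/
theorem card_le_of_blockAvoid (b f : ℕ) (P : Finset (Fin N)) (hP : ∀ p ∈ P, (p : ℕ) + b ≤ N)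
    (hsep : ∀ p ∈ P, ∀ q ∈ P, p < q → (p : ℕ) + b ≤ q)
    (Φ : Fin N → (Fin N → Bool) → Finset (Fin b → Bool))
    (hΦ : ∀ p ∈ P, ∀ v w : Fin N → Bool, (∀ i : Fin N, (i : ℕ) < p → v i = w i) → Φ p v = Φ p w)
    (hf : ∀ p ∈ P, ∀ v : Fin N → Bool, f ≤ (Φ p v).card)
    (A : Finset (Fin N → Bool))
    (hA : ∀ v ∈ A, ∀ p ∈ P,
      (fun k : Fin b => if h : (p : ℕ) + k < N then v ⟨(p : ℕ) + k, h⟩ else false) ∉ Φ p v) :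
    A.card * (2 ^ b) ^ P.card ≤ (2 ^ b - f) ^ P.card * 2 ^ N := by
  classical
  refine le_trans (Nat.mul_le_mul_right _ (card_le_card fun v hv => ?_))
    (card_filter_blockAvoid_le b f P hP hsep Φ hΦ hf)
  simp only [mem_filter, mem_univ, true_and]
  exact hA v hv

end Summit.ValiantsHypothesis.ValiantsHypothesis.Theorems.FifoMatching.NNLinearDegreeCofactorHard.BlockTests
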